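import Summits.KontsevichZagierPeriods.Zeta5Search.Barrier.ConeGammaTranslateLexKinkCriterion

/-!
# ζ(5) search — BARRIER: THE TANGENT CONE OF THE CUSP SLOPE IS ATTAINED ON A NEIGHBOURHOOD; THE DIFFERENTIABILITY
# CRITERION AT EVERY DISPLACEMENT (ties of any multiplicity) — file (1) of «THE UNIFORM TANGENT CONE»

HONEST FRAMING (cell `pub-zeta5`): systematic search; no irrationality claim unless kernel-certified. MODEL objects
under Brown–Zudilin's (28)+(30) accounting ([BZ22] = arXiv:2210.03391; (28) observed, not proved); nothing here is a
statement about `ζ(5)`, any `γ` of record, the cone's supremum (C2 OPEN) or the value / sign of the cusp slope, of a chamber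
weight or of a derivative at a named direction (DATA of the cell); NO cancellation is quantified; S-E / (TD_A) stay
CONJECTURED; records in print UNMOVED. Prover P2 g43 (item «THE UNIFORM TANGENT CONE» = P2 g42's successor menu (d)
«the kink criterion at a MULTIPLE tie», with (b); plan INBOX 2026-08-28). Sources: P2 g33 `ConeGammaCuspPeriodCanonical`
(chamber formula `cuspSlope_eq_greedy_canonical_of_refines`), P2 g30 `ConeGammaCuspChamberCover` (`exists_generic_refines`),
P2 g42 `ConeGammaCuspSlopeLexGerm` (`hasDerivWithinAt_cuspSlope_of_lex`, `lex_functional_eq`, `sign_window`,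
`exists_common_window`) and `ConeGammaTranslateLexKinkCriterion` (`eventually_refines_nhds`).

SETTING. `a` with all 28 forms positive, `T > 0` a period, `σ = cuspSlope a T`, rates `r_k(θ) = φ_k(θ)/h_k(a)`, `F` the
canonical period pattern function, `W_k(δ₀) = F(P≤(k)) − F(P<(k))` the canonical chamber weights of a generic reference `δ₀`.
P2 g42 proved the LEXICOGRAPHIC GERM `σ(δ + t·Δ) = σ(δ) + t·Σ_k W_k(δ₀)·r_k(Δ)` on an initial segment `[0, t₀(Δ)]` and decided
differentiability at SIMPLE ties. Here the segment is made UNIFORM and the criterion is extended to EVERY displacement: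
* **`cuspSlope_sub_eq_greedy_of_near`, `cuspSlope_eq_add_lex_functional_of_near` / `…_eventually` — THE TANGENT CONE IS
  ATTAINED ON A NEIGHBOURHOOD**: for every `δ'` keeping the strict rate inequalities of `δ` (all `δ'` near `δ`) and every
  generic `δ₀` refining `δ'` (equivalently: refining the lexicographic order of `(δ, δ' − δ)`),
  **`σ(δ') = σ(δ) + Σ_k W_k(δ₀)·r_k(δ' − δ)`** — the germ holds with `t = 1` for ALL small `Δ = δ' − δ` at once: near EVERY
  displacement `σ` is `σ(δ)` plus a positively homogeneous piecewise-linear function of `δ' − δ` (its one-sided derivative);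
* **`greedy_eq_fderiv_of_differentiableAt`** — where `σ` is differentiable, the canonical chamber functional of EVERY generic
  reference refining `δ` IS the derivative; **`differentiableAt_cuspSlope_of_greedy_eq`** — conversely, if all generic
  references refining `δ` carry one functional, `σ` is differentiable at `δ` with that derivative;
  **`differentiableAt_cuspSlope_iff_greedy_eq` — THE DIFFERENTIABILITY CRITERION AT EVERY DISPLACEMENT (ties of any
  multiplicity): `σ` is differentiable at `δ` iff any two generic references refining `δ` have the same chamber functional**
  (at a simple tie the two references differ by one adjacent transposition and this is g42's `m_F = 0`);
* **`cuspSlope_eq_affine_near_of_differentiableAt`, `differentiableAt_cuspSlope_eventually` — WHERE `σ` IS DIFFERENTIABLE IT IS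
  AFFINE ON A NEIGHBOURHOOD**: the differentiability locus of `σ` is OPEN and `fderiv σ` is locally constant on it (conic +
  differentiable = affine).
Files (2) `ConeGammaCuspSlopeTangentConeWalls` (combinatorial sufficient / necessary conditions, the extremum criterion),
(3) `ConeGammaTranslateTangentCone` (the same for the translate integral `P` inside the rate ball) and (4)
`ConeGammaTranslateTangentConeOrbit` (the closed orbit `δ = 0`) continue.
NOT here (honest): which references are realised at a named direction, any value of `W_k` or of a derivative (DATA); whether
«kink zero in every direction» already forces differentiability at a multiple tie (it does NOT follow from these theorems);
`Φ`, `γ`, C2, S-E's truth, `ζ(5)`.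
-/

noncomputable section

open Set Finset Filter
open scoped Topology

namespace Summit.KontsevichZagierPeriods.Zeta5Search.Barrier.ConeGamma

/-! ### References of nearby points are lexicographic references -/

/-- Rates of a difference: `r_k(δ' − δ) = r_k(δ') − r_k(δ)`. -/
theorem rate_sub (a : Dir) (δ δ' : Fin 8 → ℝ) (k : Fin 28) :
    phiForm (δ' - δ) k / h28 a k = phiForm δ' k / h28 a k - phiForm δ k / h28 a k := by
  rw [sub_eq_add_neg, phiForm_add, phiForm_neg]; ring

/-- **A reference of a nearby point is a lexicographic reference.** If `δ'` keeps every strict rate inequality of `δ` (true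
for all `δ'` near `δ`, `eventually_refines_nhds`) and `δ₀` refines `δ'`, then `δ₀` refines the lexicographic order of the pair
`(δ, δ' − δ)` (in particular it refines `δ`). -/
theorem refines_lex_of_near {a : Dir} {δ δ' δ₀ : Fin 8 → ℝ}
    (hnear : ∀ k l : Fin 28, phiForm δ k / h28 a k < phiForm δ l / h28 a l →
      phiForm δ' k / h28 a k < phiForm δ' l / h28 a l)
    (href : ∀ k l : Fin 28, phiForm δ' k / h28 a k < phiForm δ' l / h28 a l →
      phiForm δ₀ k / h28 a k < phiForm δ₀ l / h28 a l) :
    ∀ k l : Fin 28, (phiForm δ k / h28 a k < phiForm δ l / h28 a l ∨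
        (phiForm δ k / h28 a k = phiForm δ l / h28 a l ∧
          phiForm (δ' - δ) k / h28 a k < phiForm (δ' - δ) l / h28 a l)) →
      phiForm δ₀ k / h28 a k < phiForm δ₀ l / h28 a l := by
  intro k l h
  rcases h with h | ⟨he, hs⟩
  · exact href k l (hnear k l h)
  · rw [rate_sub, rate_sub, he] at hs
    exact href k l (by linarith)

/-- **A generic reference refining `δ` is a lexicographic reference of the pair `(δ, δ₀ − δ)`.** -/
theorem refines_lex_self_sub {a : Dir} {δ δ₀ : Fin 8 → ℝ}
    (href : ∀ k l : Fin 28, phiForm δ k / h28 a k < phiForm δ l / h28 a l →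
      phiForm δ₀ k / h28 a k < phiForm δ₀ l / h28 a l) :
    ∀ k l : Fin 28, (phiForm δ k / h28 a k < phiForm δ l / h28 a l ∨
        (phiForm δ k / h28 a k = phiForm δ l / h28 a l ∧
          phiForm (δ₀ - δ) k / h28 a k < phiForm (δ₀ - δ) l / h28 a l)) →
      phiForm δ₀ k / h28 a k < phiForm δ₀ l / h28 a l := by
  intro k l h
  rcases h with h | ⟨he, hs⟩
  · exact href k l h
  · rw [rate_sub, rate_sub, he] at hs
    linarith

/-! ### THE TANGENT CONE IS ATTAINED ON A NEIGHBOURHOOD -/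

/-- **THE TANGENT CONE IS ATTAINED ON A NEIGHBOURHOOD — reference form.** All 28 forms of `a` positive, `T > 0` a period, `F`
the canonical period pattern function. If `δ'` keeps the strict rate inequalities of `δ` and `δ₀` is a generic reference
refining `δ'`, then **`cuspSlope a T δ' − cuspSlope a T δ = Σ_k W_k(δ₀)·φ_k(δ' − δ)/h_k(a)`** (both `δ'` and `δ` lie in the closed
chamber of `δ₀`: P2 g33's chamber formula at both). -/
theorem cuspSlope_sub_eq_greedy_of_near {a : Dir} (hpos : ∀ k, 0 < h28 a k) {T : ℝ} (hT : 0 < T)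
    (hper : ∀ k : Fin 28, ∃ z : ℤ, T * h28 a k = z) {F : Finset (Fin 28) → ℝ}
    (hF : ∀ A, F A = ∑ m ∈ Finset.range ((bkpts a T).card - 1), ((patternN a (bkpt a T m) A : ℤ) : ℝ))
    {δ δ' δ₀ : Fin 8 → ℝ}
    (hnear : ∀ k l : Fin 28, phiForm δ k / h28 a k < phiForm δ l / h28 a l →
      phiForm δ' k / h28 a k < phiForm δ' l / h28 a l)
    (hgen : ∀ k l : Fin 28, k ≠ l → phiForm δ₀ k / h28 a k ≠ phiForm δ₀ l / h28 a l)
    (href : ∀ k l : Fin 28, phiForm δ' k / h28 a k < phiForm δ' l / h28 a l →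
      phiForm δ₀ k / h28 a k < phiForm δ₀ l / h28 a l) :
    cuspSlope a T δ' - cuspSlope a T δ =
      ∑ k, (F (Finset.univ.filter fun l => phiForm δ₀ k / h28 a k ≤ phiForm δ₀ l / h28 a l) -
          F (Finset.univ.filter fun l => phiForm δ₀ k / h28 a k < phiForm δ₀ l / h28 a l)) *
        (phiForm (δ' - δ) k / h28 a k) := by
  rw [cuspSlope_eq_greedy_canonical_of_refines hpos hT hper hF hgen δ' href,
    cuspSlope_eq_greedy_canonical_of_refines hpos hT hper hF hgen δ fun k l h => href k l (hnear k l h),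
    ← Finset.sum_sub_distrib]
  refine Finset.sum_congr rfl fun k _ => ?_
  rw [rate_sub]; ring

/-- **THE TANGENT CONE IS ATTAINED ON A NEIGHBOURHOOD — lexicographic form.** All 28 forms of `a` positive, `T > 0` a period,
`F` the canonical period pattern function. If `δ'` keeps the strict rate inequalities of `δ` and `δ₀` is ANY generic reference
refining the lexicographic order of `(δ, δ' − δ)`, then **`cuspSlope a T δ' = cuspSlope a T δ + Σ_k W_k(δ₀)·φ_k(δ' − δ)/h_k(a)`**:
P2 g42's germ `σ(δ + t·Δ) = σ(δ) + t·(one-sided derivative along Δ)` holds with `t = 1` for every small `Δ` — UNIFORMLY in the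
direction. -/
theorem cuspSlope_eq_add_lex_functional_of_near {a : Dir} (hpos : ∀ k, 0 < h28 a k) {T : ℝ} (hT : 0 < T)
    (hper : ∀ k : Fin 28, ∃ z : ℤ, T * h28 a k = z) {F : Finset (Fin 28) → ℝ}
    (hF : ∀ A, F A = ∑ m ∈ Finset.range ((bkpts a T).card - 1), ((patternN a (bkpt a T m) A : ℤ) : ℝ))
    {δ δ' : Fin 8 → ℝ}
    (hnear : ∀ k l : Fin 28, phiForm δ k / h28 a k < phiForm δ l / h28 a l →
      phiForm δ' k / h28 a k < phiForm δ' l / h28 a l)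
    {δ₀ : Fin 8 → ℝ} (hgen : ∀ k l : Fin 28, k ≠ l → phiForm δ₀ k / h28 a k ≠ phiForm δ₀ l / h28 a l)
    (hlex : ∀ k l : Fin 28, (phiForm δ k / h28 a k < phiForm δ l / h28 a l ∨
        (phiForm δ k / h28 a k = phiForm δ l / h28 a l ∧
          phiForm (δ' - δ) k / h28 a k < phiForm (δ' - δ) l / h28 a l)) →
      phiForm δ₀ k / h28 a k < phiForm δ₀ l / h28 a l) :
    cuspSlope a T δ' = cuspSlope a T δ +
      ∑ k, (F (Finset.univ.filter fun l => phiForm δ₀ k / h28 a k ≤ phiForm δ₀ l / h28 a l) -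
          F (Finset.univ.filter fun l => phiForm δ₀ k / h28 a k < phiForm δ₀ l / h28 a l)) *
        (phiForm (δ' - δ) k / h28 a k) := by
  obtain ⟨δ₁, hgen₁, href₁⟩ := exists_generic_refines hpos δ'
  have h := cuspSlope_sub_eq_greedy_of_near hpos hT hper hF hnear hgen₁ href₁
  rw [lex_functional_eq hpos hT hper hF δ (δ' - δ) hgen₁ hgen (refines_lex_of_near hnear href₁) hlex] at h
  linarith

/-- **THE TANGENT CONE IS ATTAINED ON A NEIGHBOURHOOD — filter form**: for all `δ'` near `δ` and every generic reference `δ₀`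
refining the lexicographic order of `(δ, δ' − δ)`, `σ(δ') = σ(δ) + Σ_k W_k(δ₀)·r_k(δ' − δ)`. -/
theorem cuspSlope_eq_add_lex_functional_eventually {a : Dir} (hpos : ∀ k, 0 < h28 a k) {T : ℝ} (hT : 0 < T)
    (hper : ∀ k : Fin 28, ∃ z : ℤ, T * h28 a k = z) {F : Finset (Fin 28) → ℝ}
    (hF : ∀ A, F A = ∑ m ∈ Finset.range ((bkpts a T).card - 1), ((patternN a (bkpt a T m) A : ℤ) : ℝ))
    (δ : Fin 8 → ℝ) :
    ∀ᶠ δ' in 𝓝 δ, ∀ δ₀ : Fin 8 → ℝ,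
      (∀ k l : Fin 28, k ≠ l → phiForm δ₀ k / h28 a k ≠ phiForm δ₀ l / h28 a l) →
      (∀ k l : Fin 28, (phiForm δ k / h28 a k < phiForm δ l / h28 a l ∨
          (phiForm δ k / h28 a k = phiForm δ l / h28 a l ∧
            phiForm (δ' - δ) k / h28 a k < phiForm (δ' - δ) l / h28 a l)) →
        phiForm δ₀ k / h28 a k < phiForm δ₀ l / h28 a l) →
      cuspSlope a T δ' = cuspSlope a T δ +
        ∑ k, (F (Finset.univ.filter fun l => phiForm δ₀ k / h28 a k ≤ phiForm δ₀ l / h28 a l) -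
            F (Finset.univ.filter fun l => phiForm δ₀ k / h28 a k < phiForm δ₀ l / h28 a l)) *
          (phiForm (δ' - δ) k / h28 a k) := by
  filter_upwards [eventually_refines_nhds a δ] with δ' hnear δ₀ hgen hlex
  exact cuspSlope_eq_add_lex_functional_of_near hpos hT hper hF hnear hgen hlex

/-! ### Where `σ` is differentiable, every refining chamber functional is the derivative -/

/-- A canonical chamber functional is linear along a segment. -/
theorem greedy_add_smul {a : Dir} (F : Finset (Fin 28) → ℝ) (δ₀ Δ₁ Δ₂ : Fin 8 → ℝ) (s : ℝ) :
    ∑ k, (F (Finset.univ.filter fun l => phiForm δ₀ k / h28 a k ≤ phiForm δ₀ l / h28 a l) -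
          F (Finset.univ.filter fun l => phiForm δ₀ k / h28 a k < phiForm δ₀ l / h28 a l)) *
        (phiForm (Δ₁ + s • Δ₂) k / h28 a k) =
      ∑ k, (F (Finset.univ.filter fun l => phiForm δ₀ k / h28 a k ≤ phiForm δ₀ l / h28 a l) -
          F (Finset.univ.filter fun l => phiForm δ₀ k / h28 a k < phiForm δ₀ l / h28 a l)) *
        (phiForm Δ₁ k / h28 a k) +
      s * ∑ k, (F (Finset.univ.filter fun l => phiForm δ₀ k / h28 a k ≤ phiForm δ₀ l / h28 a l) -
          F (Finset.univ.filter fun l => phiForm δ₀ k / h28 a k < phiForm δ₀ l / h28 a l)) *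
        (phiForm Δ₂ k / h28 a k) := by
  rw [Finset.mul_sum, ← Finset.sum_add_distrib]
  refine Finset.sum_congr rfl fun k _ => ?_
  rw [rate_add_smul]; ring

/-- **A chamber functional is a continuous linear map** (packaging; no value asserted). -/
theorem exists_clm_greedy (a : Dir) (W : Fin 28 → ℝ) :
    ∃ L : (Fin 8 → ℝ) →L[ℝ] ℝ, ∀ Δ, L Δ = ∑ k, W k * (phiForm Δ k / h28 a k) := by
  let Lₗ : (Fin 8 → ℝ) →ₗ[ℝ] ℝ :=
    { toFun := fun Δ => ∑ k, W k * (phiForm Δ k / h28 a k)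
      map_add' := fun Δ Δ' => by
        rw [← Finset.sum_add_distrib]
        exact Finset.sum_congr rfl fun k _ => by rw [phiForm_add]; ring
      map_smul' := fun c Δ => by
        rw [RingHom.id_apply, smul_eq_mul, Finset.mul_sum]
        exact Finset.sum_congr rfl fun k _ => by rw [phiForm_smul]; ring }
  exact ⟨LinearMap.toContinuousLinearMap Lₗ, fun _ => rfl⟩

/-- **Where `σ` is differentiable, every one-sided directional derivative is the derivative**: if `σ` is differentiable at
`δ` and `δ₀` is a generic reference refining the lexicographic order of `(δ, Δ)`, then
`Σ_k W_k(δ₀)·φ_k(Δ)/h_k(a) = fderiv σ δ Δ` (uniqueness of the right derivative on `[0, ∞)`). -/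
theorem lex_functional_eq_fderiv {a : Dir} (hpos : ∀ k, 0 < h28 a k) {T : ℝ} (hT : 0 < T)
    (hper : ∀ k : Fin 28, ∃ z : ℤ, T * h28 a k = z) {F : Finset (Fin 28) → ℝ}
    (hF : ∀ A, F A = ∑ m ∈ Finset.range ((bkpts a T).card - 1), ((patternN a (bkpt a T m) A : ℤ) : ℝ))
    {δ : Fin 8 → ℝ} (hd : DifferentiableAt ℝ (cuspSlope a T) δ) (Δ : Fin 8 → ℝ) {δ₀ : Fin 8 → ℝ}
    (hgen : ∀ k l : Fin 28, k ≠ l → phiForm δ₀ k / h28 a k ≠ phiForm δ₀ l / h28 a l)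
    (hlex : ∀ k l : Fin 28, (phiForm δ k / h28 a k < phiForm δ l / h28 a l ∨
        (phiForm δ k / h28 a k = phiForm δ l / h28 a l ∧ phiForm Δ k / h28 a k < phiForm Δ l / h28 a l)) →
      phiForm δ₀ k / h28 a k < phiForm δ₀ l / h28 a l) :
    ∑ k, (F (Finset.univ.filter fun l => phiForm δ₀ k / h28 a k ≤ phiForm δ₀ l / h28 a l) -
          F (Finset.univ.filter fun l => phiForm δ₀ k / h28 a k < phiForm δ₀ l / h28 a l)) *
        (phiForm Δ k / h28 a k) = fderiv ℝ (cuspSlope a T) δ Δ := by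
  have h1 := hasDerivWithinAt_cuspSlope_of_lex hpos hT hper hF δ Δ hgen hlex
  have hF' : HasFDerivAt (cuspSlope a T) (fderiv ℝ (cuspSlope a T) δ) (δ + (0 : ℝ) • Δ) := by
    rw [zero_smul, add_zero]; exact hd.hasFDerivAt
  have hline : HasDerivAt (fun t : ℝ => δ + t • Δ) Δ 0 := by
    simpa using ((hasDerivAt_id (0 : ℝ)).smul_const Δ).const_add δ
  have h2 : HasDerivAt (fun t : ℝ => cuspSlope a T (δ + t • Δ)) (fderiv ℝ (cuspSlope a T) δ Δ) 0 := by
    have h := hF'.comp_hasDerivAt (0 : ℝ) hline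
    exact h
  exact UniqueDiffWithinAt.eq_deriv _ (uniqueDiffWithinAt_Ici (0 : ℝ)) h1 h2.hasDerivWithinAt

/-- **Where `σ` is differentiable, the chamber functional of EVERY generic reference refining `δ` IS the derivative**: for
`σ` differentiable at `δ` and `δ₀` generic refining `δ`, `Σ_k W_k(δ₀)·φ_k(Δ)/h_k(a) = fderiv σ δ Δ` for EVERY `Δ` (the reference
refines the lexicographic order of `(δ, (δ₀ − δ) + s·Δ)` for all small `s ≥ 0`; linearity in `s`). -/
theorem greedy_eq_fderiv_of_differentiableAt {a : Dir} (hpos : ∀ k, 0 < h28 a k) {T : ℝ} (hT : 0 < T)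
    (hper : ∀ k : Fin 28, ∃ z : ℤ, T * h28 a k = z) {F : Finset (Fin 28) → ℝ}
    (hF : ∀ A, F A = ∑ m ∈ Finset.range ((bkpts a T).card - 1), ((patternN a (bkpt a T m) A : ℤ) : ℝ))
    {δ : Fin 8 → ℝ} (hd : DifferentiableAt ℝ (cuspSlope a T) δ) {δ₀ : Fin 8 → ℝ}
    (hgen : ∀ k l : Fin 28, k ≠ l → phiForm δ₀ k / h28 a k ≠ phiForm δ₀ l / h28 a l)
    (href : ∀ k l : Fin 28, phiForm δ k / h28 a k < phiForm δ l / h28 a l →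
      phiForm δ₀ k / h28 a k < phiForm δ₀ l / h28 a l) (Δ : Fin 8 → ℝ) :
    ∑ k, (F (Finset.univ.filter fun l => phiForm δ₀ k / h28 a k ≤ phiForm δ₀ l / h28 a l) -
          F (Finset.univ.filter fun l => phiForm δ₀ k / h28 a k < phiForm δ₀ l / h28 a l)) *
        (phiForm Δ k / h28 a k) = fderiv ℝ (cuspSlope a T) δ Δ := by
  -- a window `(0, s₀]` on which every TIED pair reversed by `δ₀` is reversed by `(δ₀ − δ) + s·Δ` too
  obtain ⟨s₀, hs₀, hw⟩ := exists_common_window (Finset.univ : Finset (Fin 28 × Fin 28))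
    (fun kl s => phiForm δ kl.1 / h28 a kl.1 = phiForm δ kl.2 / h28 a kl.2 →
      phiForm δ₀ kl.2 / h28 a kl.2 < phiForm δ₀ kl.1 / h28 a kl.1 →
        phiForm ((δ₀ - δ) + s • Δ) kl.2 / h28 a kl.2 < phiForm ((δ₀ - δ) + s • Δ) kl.1 / h28 a kl.1)
    (fun kl _ => by
      by_cases htie : phiForm δ kl.1 / h28 a kl.1 = phiForm δ kl.2 / h28 a kl.2
      · by_cases hlt : phiForm δ₀ kl.2 / h28 a kl.2 < phiForm δ₀ kl.1 / h28 a kl.1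
        · obtain ⟨t₀, ht₀, h⟩ := sign_window
            (phiForm (δ₀ - δ) kl.1 / h28 a kl.1 - phiForm (δ₀ - δ) kl.2 / h28 a kl.2)
            (phiForm Δ kl.1 / h28 a kl.1 - phiForm Δ kl.2 / h28 a kl.2)
          refine ⟨t₀, ht₀, fun t ht hle _ _ => ?_⟩
          have hp : 0 < phiForm (δ₀ - δ) kl.1 / h28 a kl.1 - phiForm (δ₀ - δ) kl.2 / h28 a kl.2 := by
            rw [rate_sub, rate_sub]; linarith
          have e : phiForm ((δ₀ - δ) + t • Δ) kl.1 / h28 a kl.1 - phiForm ((δ₀ - δ) + t • Δ) kl.2 / h28 a kl.2 =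
              (phiForm (δ₀ - δ) kl.1 / h28 a kl.1 - phiForm (δ₀ - δ) kl.2 / h28 a kl.2) +
                t * (phiForm Δ kl.1 / h28 a kl.1 - phiForm Δ kl.2 / h28 a kl.2) := by
            rw [rate_add_smul, rate_add_smul]; ring
          have h' := (h t ht hle).mpr (Or.inl hp)
          linarith
        · exact ⟨1, one_pos, fun t _ _ _ h => absurd h hlt⟩
      · exact ⟨1, one_pos, fun t _ _ h _ => absurd h htie⟩)
  -- hence `δ₀` refines the lexicographic order of `(δ, (δ₀ − δ) + s₀·Δ)`
  have hlex : ∀ k l : Fin 28, (phiForm δ k / h28 a k < phiForm δ l / h28 a l ∨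
      (phiForm δ k / h28 a k = phiForm δ l / h28 a l ∧
        phiForm ((δ₀ - δ) + s₀ • Δ) k / h28 a k < phiForm ((δ₀ - δ) + s₀ • Δ) l / h28 a l)) →
      phiForm δ₀ k / h28 a k < phiForm δ₀ l / h28 a l := by
    intro k l h
    rcases h with h | ⟨he, hlt⟩
    · exact href k l h
    · rcases lt_trichotomy (phiForm δ₀ k / h28 a k) (phiForm δ₀ l / h28 a l) with h1 | h1 | h1
      · exact h1
      · by_cases hkl : k = l
        · subst hkl; exact absurd hlt (lt_irrefl _)
        · exact absurd h1 (hgen k l hkl)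
      · exact absurd (hw s₀ hs₀ le_rfl (k, l) (Finset.mem_univ _) he h1) (lt_asymm hlt)
  -- the two directional identities and linearity in `s`
  have e1 := lex_functional_eq_fderiv hpos hT hper hF hd ((δ₀ - δ) + s₀ • Δ) hgen hlex
  have e0 := lex_functional_eq_fderiv hpos hT hper hF hd (δ₀ - δ) hgen (refines_lex_self_sub href)
  rw [greedy_add_smul, e0, map_add, map_smul, smul_eq_mul] at e1
  exact mul_left_cancel₀ hs₀.ne' (add_left_cancel e1)

/-! ### THE DIFFERENTIABILITY CRITERION AT EVERY DISPLACEMENT -/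

/-- **ONE FUNCTIONAL ON ALL REFINING REFERENCES ⇒ `σ` IS DIFFERENTIABLE.** All 28 forms of `a` positive, `T > 0` a period, `F`
the canonical period pattern function; `δ₁` a reference (meant: generic, refining `δ`) such that EVERY generic reference refining
`δ` has the chamber functional of `δ₁`. Then `σ` is differentiable at `δ` and `fderiv σ δ Δ = Σ_k W_k(δ₁)·φ_k(Δ)/h_k(a)` (near `δ`
every point has a generic reference refining it and `δ`: `σ` is AFFINE on a neighbourhood). -/
theorem differentiableAt_cuspSlope_of_greedy_eq {a : Dir} (hpos : ∀ k, 0 < h28 a k) {T : ℝ} (hT : 0 < T)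
    (hper : ∀ k : Fin 28, ∃ z : ℤ, T * h28 a k = z) {F : Finset (Fin 28) → ℝ}
    (hF : ∀ A, F A = ∑ m ∈ Finset.range ((bkpts a T).card - 1), ((patternN a (bkpt a T m) A : ℤ) : ℝ))
    {δ δ₁ : Fin 8 → ℝ}
    (hall : ∀ δ₀ : Fin 8 → ℝ, (∀ k l : Fin 28, k ≠ l → phiForm δ₀ k / h28 a k ≠ phiForm δ₀ l / h28 a l) →
      (∀ k l : Fin 28, phiForm δ k / h28 a k < phiForm δ l / h28 a l →
        phiForm δ₀ k / h28 a k < phiForm δ₀ l / h28 a l) →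
      ∀ Δ : Fin 8 → ℝ,
        ∑ k, (F (Finset.univ.filter fun l => phiForm δ₀ k / h28 a k ≤ phiForm δ₀ l / h28 a l) -
            F (Finset.univ.filter fun l => phiForm δ₀ k / h28 a k < phiForm δ₀ l / h28 a l)) *
          (phiForm Δ k / h28 a k) =
        ∑ k, (F (Finset.univ.filter fun l => phiForm δ₁ k / h28 a k ≤ phiForm δ₁ l / h28 a l) -
            F (Finset.univ.filter fun l => phiForm δ₁ k / h28 a k < phiForm δ₁ l / h28 a l)) *
          (phiForm Δ k / h28 a k)) :
    DifferentiableAt ℝ (cuspSlope a T) δ ∧ ∀ Δ : Fin 8 → ℝ, fderiv ℝ (cuspSlope a T) δ Δ =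
      ∑ k, (F (Finset.univ.filter fun l => phiForm δ₁ k / h28 a k ≤ phiForm δ₁ l / h28 a l) -
          F (Finset.univ.filter fun l => phiForm δ₁ k / h28 a k < phiForm δ₁ l / h28 a l)) *
        (phiForm Δ k / h28 a k) := by
  obtain ⟨L, hLapply⟩ := exists_clm_greedy a fun k =>
    F (Finset.univ.filter fun l => phiForm δ₁ k / h28 a k ≤ phiForm δ₁ l / h28 a l) -
      F (Finset.univ.filter fun l => phiForm δ₁ k / h28 a k < phiForm δ₁ l / h28 a l)
  have haff : (fun δ' => cuspSlope a T δ + (L δ' - L δ)) =ᶠ[𝓝 δ] cuspSlope a T := by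
    filter_upwards [eventually_refines_nhds a δ] with δ' hnear
    obtain ⟨δ₀, hgen₀, href₀⟩ := exists_generic_refines hpos δ'
    have h := cuspSlope_sub_eq_greedy_of_near hpos hT hper hF hnear hgen₀ href₀
    rw [hall δ₀ hgen₀ (fun k l hkl => href₀ k l (hnear k l hkl)) (δ' - δ), ← hLapply] at h
    rw [← map_sub]
    linarith
  have h1 : HasFDerivAt (fun δ' => cuspSlope a T δ + (L δ' - L δ)) L δ :=
    (L.hasFDerivAt.sub_const (L δ)).const_add (cuspSlope a T δ)
  have h2 := h1.congr_of_eventuallyEq haff.symm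
  exact ⟨h2.differentiableAt, fun Δ => by rw [h2.fderiv, hLapply]⟩

/-- **THE DIFFERENTIABILITY CRITERION AT EVERY DISPLACEMENT (ties of any multiplicity).** All 28 forms of `a` positive, `T > 0`
a period, `F` the canonical period pattern function. Then **`σ` is differentiable at `δ` iff any two generic references `δ₀`,
`δ₀'` refining `δ` have the same canonical chamber functional** `Δ ↦ Σ_k W_k·φ_k(Δ)/h_k(a)`. At a generic `δ` there is one
reference order; at a simple tie two, differing by one adjacent transposition (P2 g42's criterion `m_F = 0`); at a multiple
tie as many as the orders of the tied classes realised near `δ`. -/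
theorem differentiableAt_cuspSlope_iff_greedy_eq {a : Dir} (hpos : ∀ k, 0 < h28 a k) {T : ℝ} (hT : 0 < T)
    (hper : ∀ k : Fin 28, ∃ z : ℤ, T * h28 a k = z) {F : Finset (Fin 28) → ℝ}
    (hF : ∀ A, F A = ∑ m ∈ Finset.range ((bkpts a T).card - 1), ((patternN a (bkpt a T m) A : ℤ) : ℝ))
    (δ : Fin 8 → ℝ) :
    DifferentiableAt ℝ (cuspSlope a T) δ ↔
      ∀ δ₀ δ₀' : Fin 8 → ℝ, (∀ k l : Fin 28, k ≠ l → phiForm δ₀ k / h28 a k ≠ phiForm δ₀ l / h28 a l) →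
        (∀ k l : Fin 28, k ≠ l → phiForm δ₀' k / h28 a k ≠ phiForm δ₀' l / h28 a l) →
        (∀ k l : Fin 28, phiForm δ k / h28 a k < phiForm δ l / h28 a l →
          phiForm δ₀ k / h28 a k < phiForm δ₀ l / h28 a l) →
        (∀ k l : Fin 28, phiForm δ k / h28 a k < phiForm δ l / h28 a l →
          phiForm δ₀' k / h28 a k < phiForm δ₀' l / h28 a l) →
        ∀ Δ : Fin 8 → ℝ,
          ∑ k, (F (Finset.univ.filter fun l => phiForm δ₀ k / h28 a k ≤ phiForm δ₀ l / h28 a l) -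
              F (Finset.univ.filter fun l => phiForm δ₀ k / h28 a k < phiForm δ₀ l / h28 a l)) *
            (phiForm Δ k / h28 a k) =
          ∑ k, (F (Finset.univ.filter fun l => phiForm δ₀' k / h28 a k ≤ phiForm δ₀' l / h28 a l) -
              F (Finset.univ.filter fun l => phiForm δ₀' k / h28 a k < phiForm δ₀' l / h28 a l)) *
            (phiForm Δ k / h28 a k) := by
  constructor
  · intro hd δ₀ δ₀' hgen hgen' href href' Δ
    rw [greedy_eq_fderiv_of_differentiableAt hpos hT hper hF hd hgen href Δ,
      greedy_eq_fderiv_of_differentiableAt hpos hT hper hF hd hgen' href' Δ]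
  · intro h
    obtain ⟨δ₁, hgen₁, href₁⟩ := exists_generic_refines hpos δ
    exact (differentiableAt_cuspSlope_of_greedy_eq hpos hT hper hF
      fun δ₀ hgen₀ href₀ Δ => h δ₀ δ₁ hgen₀ hgen₁ href₀ href₁ Δ).1

/-! ### Where `σ` is differentiable it is affine on a neighbourhood -/

/-- **WHERE `σ` IS DIFFERENTIABLE IT IS AFFINE ON A NEIGHBOURHOOD**: if `σ` is differentiable at `δ` then
`σ(δ') = σ(δ) + fderiv σ δ (δ' − δ)` for all `δ'` near `δ` (conic structure + differentiability). -/
theorem cuspSlope_eq_affine_near_of_differentiableAt {a : Dir} (hpos : ∀ k, 0 < h28 a k) {T : ℝ} (hT : 0 < T)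
    (hper : ∀ k : Fin 28, ∃ z : ℤ, T * h28 a k = z) {F : Finset (Fin 28) → ℝ}
    (hF : ∀ A, F A = ∑ m ∈ Finset.range ((bkpts a T).card - 1), ((patternN a (bkpt a T m) A : ℤ) : ℝ))
    {δ : Fin 8 → ℝ} (hd : DifferentiableAt ℝ (cuspSlope a T) δ) :
    ∀ᶠ δ' in 𝓝 δ, cuspSlope a T δ' = cuspSlope a T δ + fderiv ℝ (cuspSlope a T) δ (δ' - δ) := by
  filter_upwards [eventually_refines_nhds a δ] with δ' hnear
  obtain ⟨δ₀, hgen₀, href₀⟩ := exists_generic_refines hpos δ'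
  have h := cuspSlope_sub_eq_greedy_of_near hpos hT hper hF hnear hgen₀ href₀
  rw [greedy_eq_fderiv_of_differentiableAt hpos hT hper hF hd hgen₀ (fun k l hkl => href₀ k l (hnear k l hkl))
    (δ' - δ)] at h
  linarith

/-- **THE DIFFERENTIABILITY LOCUS OF `σ` IS OPEN AND `fderiv σ` IS LOCALLY CONSTANT ON IT**: if `σ` is differentiable at `δ`,
then at every `δ'` near `δ` it is differentiable with `fderiv σ δ' = fderiv σ δ`. -/
theorem differentiableAt_cuspSlope_eventually {a : Dir} (hpos : ∀ k, 0 < h28 a k) {T : ℝ} (hT : 0 < T)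
    (hper : ∀ k : Fin 28, ∃ z : ℤ, T * h28 a k = z) {F : Finset (Fin 28) → ℝ}
    (hF : ∀ A, F A = ∑ m ∈ Finset.range ((bkpts a T).card - 1), ((patternN a (bkpt a T m) A : ℤ) : ℝ))
    {δ : Fin 8 → ℝ} (hd : DifferentiableAt ℝ (cuspSlope a T) δ) :
    ∀ᶠ δ' in 𝓝 δ, DifferentiableAt ℝ (cuspSlope a T) δ' ∧
      fderiv ℝ (cuspSlope a T) δ' = fderiv ℝ (cuspSlope a T) δ := by
  filter_upwards [(cuspSlope_eq_affine_near_of_differentiableAt hpos hT hper hF hd).eventually_nhds] with δ' h'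
  have h1 : HasFDerivAt (fun x => cuspSlope a T δ + (fderiv ℝ (cuspSlope a T) δ x - fderiv ℝ (cuspSlope a T) δ δ))
      (fderiv ℝ (cuspSlope a T) δ) δ' :=
    ((fderiv ℝ (cuspSlope a T) δ).hasFDerivAt.sub_const _).const_add (cuspSlope a T δ)
  have heq : (fun x => cuspSlope a T δ + (fderiv ℝ (cuspSlope a T) δ x - fderiv ℝ (cuspSlope a T) δ δ)) =ᶠ[𝓝 δ']
      cuspSlope a T := by
    filter_upwards [h'] with x hx
    rw [hx, map_sub]
  have h2 := h1.congr_of_eventuallyEq heq.symm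
  exact ⟨h2.differentiableAt, h2.fderiv⟩

end Summit.KontsevichZagierPeriods.Zeta5Search.Barrier.ConeGamma

end
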